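/-
Copyright: the b2b-balaban T⁴-continuum CRUX team, row NE7b OWNER lineage `t4-ne7b-p1` (gen 124). Project licence.
-/
import Summits.QuantumFields.BalabanUV.T4Continuum.Spine.NE7b.SupZdPerturbedCoarseInverseLipschitz

/-!
# THE PERTURBED INFINITE-VOLUME RESPONSE KERNEL: for `V : ℤ^d → [−λ, Λ]` (`d ≥ 3`, every mesh), a kernel `|K(p,q)| ≤ εe^{−γ|p − q|₁}` under
# the three smallness conditions of (218)∕(219), and every coarse point `b₀`, the response `h^K_{b₀} = Σ′_{b′}N_K(b′,b₀)Ψ^K_{b′}` of the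
# `H + K` column on `ℤ^d` (perturbed block columns `Ψ^K` superposed with (219)'s two-sided inverse `N_K` of the perturbed coarse operator)
# converges absolutely, decays like `e^{−ν|blk n p − b₀|₁}` WITHOUT rate halving, has unit block means `Q′h^K_{b₀} = e_{b₀}`, and solves
# `(H_V + K)h^K_{b₀} = N_K(blk n ·, b₀)` — the two displays that DEFINE the perturbed road's response `D_Ke_{b₀}`, now on `ℤ^d`; (200)'s
# `H + K` twin (row NE7b, node U5c; (214)∕(219) BY NAME; [folklore])

Cell `pub-balaban`, sub-cell `t4`, spine estimate NE7b (`T4WeightBudget.RelWeightBound`; the cell's OWN estimate — NOT PRINTED in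
[Bałaban 1983–89], NOT PROVED).  Crux-route work under `Spine/NE7b/` by the row OWNER (`t4-ne7b-p1` gen 124, file (220)) under FREEZE
(0)'s crux-prover clause; NOTHING of Bałaban's is named as a Lean object, valued or asserted; no `T4Continuum/Support` leaf typed; no `def`,
no notation (`h^K_{b₀}`, `T_K`, `C_M′` WRITTEN OUT; `M`, `Ψ`, `Ψ^K` are DATA with their defining properties; the block-scale decay of `Ψ^K` is a
HYPOTHESIS with a free constant `C_Ψ`, discharged by (216) (ii) with `C_Ψ = 2C_PK_{δ₀−μ}`); zero `sorry`.  Imports (BY NAME): the OWNER's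
(219) `…SupZdPerturbedCoarseInverseLipschitz` (`zd_perturbed_coarse_inverse_lipschitz`; through it (214) `tsum_exp_conv_noLoss`, (189)
`summable_exp_l1`, (191) `natAbs_sub_comm_sum`), Mathlib's `Summable.mul_of_nonneg`, `Summable.tsum_comm`, `Summable.prod`,
`Summable.tsum_finsetSum`, `norm_tsum_le_tsum_norm`, `tsum_eq_single`.

WHY (located).  § [NE7bP1-G124-HANDOFF] NEXT (3)(a)∕(b): with `T_K` inverted on `ℤ^d` ((218)∕(219)) the perturbed column continues
exactly as the unperturbed one did after (194)∕(195): (200) built the response kernel `h_{b₀} = Σ′M(b′,b₀)Ψ_{b′}`, (201) the fluctuation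
covariance.  This file is (200) for `H + K`: the termwise bound `|N_K(b′,b₀)Ψ^K_{b′}(p)| ≤ 2C_M′C_Ψe^{−μ|blk n p − b′|₁}e^{−ν|b′ − b₀|₁}` is a
convolution of two exponentials with DIFFERENT rates `ν < μ`, so (214)'s no-loss lemma keeps the rate `ν` (where (200) halved); the
block means are `Σ′_{b′}T_K(b,b′)N_K(b′,b₀) = δ_{bb₀}` ((219)'s right identity, finite sums through the series); the equation is termwise
`(H_V + K)(N_K(b′,b₀)Ψ^K_{b′}) = N_K(b′,b₀)𝟙[blk n · = b′]` summed over `b′` — the finite stencil through the series by absolute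
convergence, and the KERNEL ROWS through the series by Fubini on `ℤ^d × ℤ^d` under the product domination
`2C_M′e^{−ν|b₀−b′|₁}C_Ψ·εe^{−γ|p−q|₁}`.

WHAT IS PROVED ([folklore]): §1 **`zd_perturbed_response_kernel`** (THE END: `∃ C₀ C_P δ₀ c₁ δ₁ > 0`: for ALL data as in (219) plus the
block-scale decay of `Ψ^K`: `∃ N` with (219)'s profile and both identities, and for every `b₀`: summability, (i) the bound
`2C_M′C_ΨK_{μ−ν}e^{−ν|blk n p − b₀|₁}`, (ii) unit block means, (iii) the perturbed equation with source `N(blk n ·, b₀)`); §2 toy.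

HONEST (what this is NOT).  The response to coarse unit sources only: the perturbed fluctuation covariance `C_K = G_K − h^KT_K…` and its
decay ((201)'s twin), Lipschitz-in-`K` of `h^K` (from (216) (iii) and (219)'s `|N_K − M|`), and the torus → `ℤ^d` limit of the `H + K` tower
are the sequel; uniqueness of `h^K_{b₀}` among bounded solutions is (213)'s and not restated; THREE smallness conditions with the sup
road's constants — NOT (163)'s energy threshold; the LINEAR column only; `d ≥ 3` only; scalar skeleton ((A3), NC-NE7b-α UNRULED); nothing of
the covariant propagators of [B4]–[B6]; nothing of Bałaban's asserted.  BY-NAME EFFECT ON THE WALL: NONE.  NE7b NOT PRINTED ∕ NOT PROVED;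
spine PROVED 0∕9; rung (B)+1 — the programme's measures remain FINITE-torus statements; NOT the mass gap, NOT Clay.  HONEST DEPENDENCY:
continuum YM on T⁴ ⇐ BetaPertH ∧ nine spine estimates (0∕9 proved); BetaPertH ⇐ (D1) ∧ (D4) ∧ CAP+tail; G-an2-4 gates asym, D1 and NE2∕3∕4.
-/

set_option autoImplicit false

noncomputable section

namespace Summit.QuantumFields.BalabanUV.T4Continuum.NE7b.SupZdPerturbedResponseKernel

open Real Filter Topology
open scoped ENNReal
open Literature.MathematicalPhysics.QuantumFieldTheory.Balaban1983to89
open B6QGQLower276 (X e blk B)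
open SupZdExponentialSums (summable_exp_l1 tsum_exp_l1_le)
open SupZdCoarseForm (natAbs_sub_comm_sum)
open SupZdProfileNoLoss (tsum_exp_conv_noLoss)
open SupZdPerturbedCoarseInverseLipschitz (zd_perturbed_coarse_inverse_lipschitz)

variable {d : ℕ}

/-! ## §1. THE END: the perturbed infinite-volume response kernel `h^K_{b₀} = Σ′_{b′}N_K(b′,b₀)Ψ^K_{b′}` -/
set_option maxHeartbeats 400000 in
/-- **HEADLINE — THE PERTURBED RESPONSE TO A UNIT COARSE SOURCE ON `ℤ^d`**: under the hypotheses of (219) (`d ≥ 3`, the road, unperturbed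
block columns `Ψ`, a cube limit `M`, `ε, γ, μ, ν` with the three smallness conditions, a kernel `K` of the class, bounded perturbed block
columns `Ψ^K`) and the block-scale decay `|Ψ^K_c(p)| ≤ C_Ψe^{−μ|blk n p − c|₁}` ((216) (ii) gives it with `C_Ψ = 2C_PK_{δ₀−μ}`): with (219)'s
two-sided inverse `N_K` of `T_K` (re-exported: profile and both identities), for every coarse `b₀` the series
`h^K_{b₀}(p) = Σ′_{b′}N_K(b′,b₀)Ψ^K_{b′}(p)` converges absolutely and (i) `|h^K_{b₀}(p)| ≤ 2C_M′C_ΨK_{μ−ν}·e^{−ν|blk n p − b₀|₁}`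
(`C_M′ = c₁e^{νd}K_{δ₁−ν}`; NO rate halving: (214)'s no-loss convolution); (ii) `Q′h^K_{b₀} = e_{b₀}` (`(n+1)^{−d}Σ_{B n b}h^K_{b₀} = δ_{bb₀}` —
`T_KN_K = 1`); (iii) `(H_V + K)h^K_{b₀} = N_K(blk n ·, b₀)` (the finite stencil AND the kernel rows through the series: Fubini on `ℤ^d × ℤ^d`)
— the two displays that DEFINE the perturbed road's response `D_Ke_{b₀}`, now on `ℤ^d` ((200)'s `H + K` twin). [folklore] -/
theorem zd_perturbed_response_kernel (hd : 3 ≤ d) (a : ℝ) (ha : 0 < a) {lam Lam : ℝ} (hlam : lam < min 2 a) (hLam : 0 ≤ Lam) :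
    ∃ C₀ CP δ₀ c₁ δ₁ : ℝ, 0 < C₀ ∧ 0 < CP ∧ 0 < δ₀ ∧ 0 < c₁ ∧ 0 < δ₁ ∧
    ∀ (n : ℕ) (V : X d → ℝ), (∀ p, -lam ≤ V p) → (∀ p, V p ≤ Lam) →
    ∀ (Ψ : X d → X d → ℝ) (BΨ : X d → ℝ), (∀ c p, |Ψ c p| ≤ BΨ c) →
      (∀ c p, ((n : ℝ) + 1) ^ 2 * ∑ μ', (2 * Ψ c p - Ψ c (p + e μ') - Ψ c (p - e μ'))
        + a / ((n : ℝ) + 1) ^ d * ∑ q ∈ B n (blk n p), Ψ c q + V p * Ψ c p = if blk n p = c then 1 else 0) →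
    ∀ (M : X d → X d → ℝ), (∀ b b' : X d, Tendsto (fun R : ℕ =>
      if h : b ∈ (Fintype.piFinset fun _ : Fin d => Finset.Icc (-(R : ℤ)) R) ∧
          b' ∈ (Fintype.piFinset fun _ : Fin d => Finset.Icc (-(R : ℤ)) R)
        then (Matrix.of fun c c' : ↥(Fintype.piFinset fun _ : Fin d => Finset.Icc (-(R : ℤ)) R) =>
          (((n : ℝ) + 1) ^ d)⁻¹ * ∑ q ∈ B n (c : X d), Ψ (c' : X d) q)⁻¹ ⟨b, h.1⟩ ⟨b', h.2⟩ else 0)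
      atTop (𝓝 (M b b'))) →
    ∀ (ε γ μ ν : ℝ), 0 ≤ ε → 0 < μ → μ < δ₀ → μ < γ → 0 < ν → ν < μ → ν < δ₁ →
      ε * (2 * (1 - exp (-γ))⁻¹) ^ d * C₀ ≤ 1 / 2 →
      (CP * (2 * (1 - exp (-(δ₀ - μ)))⁻¹) ^ d) * (ε * exp (μ * d) * (2 * (1 - exp (-(γ - μ)))⁻¹) ^ d) ≤ 1 / 2 →
      (c₁ * exp (ν * d) * (2 * (1 - exp (-(δ₁ - ν)))⁻¹) ^ d)
        * ((4 * (CP * (2 * (1 - exp (-(δ₀ - μ)))⁻¹) ^ d)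
            * ((CP * (2 * (1 - exp (-(δ₀ - μ)))⁻¹) ^ d) * (ε * exp (μ * d) * (2 * (1 - exp (-(γ - μ)))⁻¹) ^ d)))
          * exp (ν * d) * (2 * (1 - exp (-(μ - ν)))⁻¹) ^ d) ≤ 1 / 2 →
    ∀ (K : X d → X d → ℝ), (∀ p q, |K p q| ≤ ε * exp (-(γ * ∑ i, (((p i - q i).natAbs : ℕ) : ℝ)))) →
    ∀ (ΨK : X d → X d → ℝ) (BΨK : X d → ℝ), (∀ c p, |ΨK c p| ≤ BΨK c) →
      (∀ c p, ((n : ℝ) + 1) ^ 2 * ∑ μ', (2 * ΨK c p - ΨK c (p + e μ') - ΨK c (p - e μ'))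
        + a / ((n : ℝ) + 1) ^ d * ∑ q ∈ B n (blk n p), ΨK c q + V p * ΨK c p + ∑' q : X d, K p q * ΨK c q
          = if blk n p = c then 1 else 0) →
    ∀ (CΨ : ℝ), (∀ c p, |ΨK c p| ≤ CΨ * exp (-(μ * ∑ i, (((blk n p i - c i).natAbs : ℕ) : ℝ)))) →
    ∃ N : X d → X d → ℝ,
      (∀ b c, |N b c| ≤ 2 * (c₁ * exp (ν * d) * (2 * (1 - exp (-(δ₁ - ν)))⁻¹) ^ d) * exp (-(ν * ∑ i, (((b i - c i).natAbs : ℕ) : ℝ)))) ∧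
      (∀ b c, Summable (fun b' : X d => ((((n : ℝ) + 1) ^ d)⁻¹ * ∑ q ∈ B n b, ΨK b' q) * N b' c) ∧
        ∑' b' : X d, ((((n : ℝ) + 1) ^ d)⁻¹ * ∑ q ∈ B n b, ΨK b' q) * N b' c = if b = c then 1 else 0) ∧
      (∀ b c, Summable (fun b' : X d => N b b' * ((((n : ℝ) + 1) ^ d)⁻¹ * ∑ q ∈ B n b', ΨK c q)) ∧
        ∑' b' : X d, N b b' * ((((n : ℝ) + 1) ^ d)⁻¹ * ∑ q ∈ B n b', ΨK c q) = if b = c then 1 else 0) ∧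
      ∀ b₀ : X d,
        (∀ p, Summable fun b' : X d => N b' b₀ * ΨK b' p) ∧
        (∀ p, |∑' b' : X d, N b' b₀ * ΨK b' p| ≤ 2 * (c₁ * exp (ν * d) * (2 * (1 - exp (-(δ₁ - ν)))⁻¹) ^ d) * CΨ
          * (2 * (1 - exp (-(μ - ν)))⁻¹) ^ d * exp (-(ν * ∑ i, (((blk n p i - b₀ i).natAbs : ℕ) : ℝ)))) ∧
        (∀ b, (((n : ℝ) + 1) ^ d)⁻¹ * ∑ q ∈ B n b, (∑' b' : X d, N b' b₀ * ΨK b' q) = if b = b₀ then 1 else 0) ∧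
        (∀ p, ((n : ℝ) + 1) ^ 2 * ∑ μ', (2 * (∑' b' : X d, N b' b₀ * ΨK b' p) - (∑' b' : X d, N b' b₀ * ΨK b' (p + e μ'))
            - (∑' b' : X d, N b' b₀ * ΨK b' (p - e μ')))
          + a / ((n : ℝ) + 1) ^ d * ∑ q ∈ B n (blk n p), (∑' b' : X d, N b' b₀ * ΨK b' q)
          + V p * (∑' b' : X d, N b' b₀ * ΨK b' p) + ∑' q : X d, K p q * (∑' b' : X d, N b' b₀ * ΨK b' q)
          = N (blk n p) b₀) := by
  classical
  obtain ⟨C₀, CP, δ₀, c₁, δ₁, hC₀, hCP, hδ₀, hc₁, hδ₁, H219⟩ := zd_perturbed_coarse_inverse_lipschitz (d := d) hd a ha hlam hLam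
  refine ⟨C₀, CP, δ₀, c₁, δ₁, hC₀, hCP, hδ₀, hc₁, hδ₁, ?_⟩
  intro n V hV hV' Ψ BΨ hΨB hΨ M hM ε γ μ ν hε hμ hμδ hμγ hν hνμ hνδ hsmall1 hsmall2 hsmall3 K hK ΨK BΨK hΨKB hΨK CΨ hΨKd
  obtain ⟨N, hNd, hright, hleft, -, -⟩ :=
    H219 n V hV hV' Ψ BΨ hΨB hΨ M hM ε γ μ ν hε hμ hμδ hμγ hν hνμ hνδ hsmall1 hsmall2 hsmall3 K hK ΨK BΨK hΨKB hΨK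
  refine ⟨N, hNd, hright, hleft, fun b₀ => ?_⟩
  have hγ : 0 < γ := lt_trans hμ hμγ
  have hKν : 0 < (2 * (1 - exp (-(δ₁ - ν)))⁻¹) ^ d := pow_pos (mul_pos two_pos (inv_pos.2 (sub_pos.2 (exp_lt_one_iff.2 (by linarith))))) d
  obtain ⟨CM, hCM⟩ : ∃ CM : ℝ, CM = c₁ * exp (ν * d) * (2 * (1 - exp (-(δ₁ - ν)))⁻¹) ^ d := ⟨_, rfl⟩
  have hCM0 : 0 < CM := by rw [hCM]; positivity
  rw [← hCM] at hNd ⊢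
  have hCΨ : 0 ≤ CΨ := by
    have h := (abs_nonneg _).trans (hΨKd b₀ 0)
    exact le_of_mul_le_mul_right (by rw [zero_mul]; exact h) (exp_pos _)
  -- termwise domination by a no-loss convolution
  have hdom : ∀ p b', |N b' b₀ * ΨK b' p| ≤ 2 * CM * CΨ * (exp (-(μ * ∑ i, (((blk n p i - b' i).natAbs : ℕ) : ℝ)))
      * exp (-(ν * ∑ i, (((b' i - b₀ i).natAbs : ℕ) : ℝ)))) := by
    intro p b'
    rw [abs_mul]
    calc |N b' b₀| * |ΨK b' p| ≤ (2 * CM * exp (-(ν * ∑ i, (((b' i - b₀ i).natAbs : ℕ) : ℝ))))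
          * (CΨ * exp (-(μ * ∑ i, (((blk n p i - b' i).natAbs : ℕ) : ℝ)))) :=
          mul_le_mul (hNd b' b₀) (hΨKd b' p) (abs_nonneg _) (by positivity)
      _ = _ := by ring
  have hs : ∀ p, Summable fun b' : X d => N b' b₀ * ΨK b' p := fun p =>
    Summable.of_norm_bounded (((tsum_exp_conv_noLoss hν.le hνμ b₀ (blk n p)).1).mul_left (2 * CM * CΨ)) fun b' => by
      rw [Real.norm_eq_abs]; exact hdom p b'
  have hbd : ∀ p, |∑' b' : X d, N b' b₀ * ΨK b' p|
      ≤ 2 * CM * CΨ * (2 * (1 - exp (-(μ - ν)))⁻¹) ^ d * exp (-(ν * ∑ i, (((blk n p i - b₀ i).natAbs : ℕ) : ℝ))) := by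
    intro p
    obtain ⟨hcs, hcb⟩ := tsum_exp_conv_noLoss (d := d) hν.le hνμ b₀ (blk n p)
    have h1 : |∑' b' : X d, N b' b₀ * ΨK b' p| ≤ ∑' b' : X d, |N b' b₀ * ΨK b' p| := by
      have := norm_tsum_le_tsum_norm (hs p).norm
      simpa only [Real.norm_eq_abs] using this
    have h2 := (hs p).abs.tsum_le_tsum (hdom p) (hcs.mul_left (2 * CM * CΨ))
    rw [Summable.tsum_mul_left _ hcs] at h2
    have h3 := mul_le_mul_of_nonneg_left hcb (show 0 ≤ 2 * CM * CΨ by positivity)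
    calc _ ≤ 2 * CM * CΨ * ((2 * (1 - exp (-(μ - ν)))⁻¹) ^ d * exp (-(ν * ∑ i, (((blk n p i - b₀ i).natAbs : ℕ) : ℝ)))) :=
        h1.trans (h2.trans h3)
      _ = _ := by ring
  refine ⟨hs, hbd, fun b => ?_, fun p => ?_⟩
  · -- block means: `(n+1)^{−d}Σ_{B n b}Σ′_{b′}N(b′,b₀)Ψ^K_{b′} = Σ′_{b′}T_K(b,b′)N(b′,b₀) = δ_{bb₀}`
    have hTN := (hright b b₀).2
    rw [← Summable.tsum_finsetSum (fun q _ => hs q), ← Summable.tsum_mul_left _ (summable_sum fun q _ => hs q), ← hTN]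
    refine tsum_congr fun b' => ?_
    rw [Finset.mul_sum, Finset.mul_sum, Finset.sum_mul]
    exact Finset.sum_congr rfl fun q _ => by ring
  · -- the kernel rows through the series: Fubini on `ℤ^d × ℤ^d`
    obtain ⟨F, hF⟩ : ∃ F : X d → X d → ℝ, ∀ b' q, F b' q = K p q * (N b' b₀ * ΨK b' q) := ⟨_, fun _ _ => rfl⟩
    have hNd' : ∀ b', |N b' b₀| ≤ 2 * CM * exp (-(ν * ∑ i, (((b₀ i - b' i).natAbs : ℕ) : ℝ))) := fun b' => by
      rw [natAbs_sub_comm_sum]; exact hNd b' b₀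
    have hΨKb : ∀ b' q, |ΨK b' q| ≤ CΨ := fun b' q =>
      (hΨKd b' q).trans (mul_le_of_le_one_right hCΨ (exp_le_one_iff.2 (neg_nonpos.2 (by positivity))))
    have hprod : Summable fun x : X d × X d => (2 * CM * exp (-(ν * ∑ i, (((b₀ i - x.1 i).natAbs : ℕ) : ℝ))) * CΨ)
        * (ε * exp (-(γ * ∑ i, (((p i - x.2 i).natAbs : ℕ) : ℝ)))) :=
      Summable.mul_of_nonneg (((summable_exp_l1 hν b₀).mul_left (2 * CM)).mul_right CΨ) ((summable_exp_l1 hγ p).mul_left ε)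
        (fun _ => by positivity) (fun _ => by positivity)
    have hFsum : Summable (Function.uncurry F) := Summable.of_norm_bounded hprod fun x => by
      simp only [Function.uncurry, hF, Real.norm_eq_abs]
      rw [abs_mul, abs_mul, mul_comm]
      exact mul_le_mul (mul_le_mul (hNd' x.1) (hΨKb x.1 x.2) (abs_nonneg _) (by positivity)) (hK p x.2) (abs_nonneg _) (by positivity)
    have hrowq : ∀ b', ∑' q : X d, F b' q = N b' b₀ * ∑' q : X d, K p q * ΨK b' q := fun b' => by
      rw [← tsum_mul_left]; exact tsum_congr fun q => by rw [hF]; ring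
    have hSK : Summable fun b' : X d => N b' b₀ * ∑' q : X d, K p q * ΨK b' q := by
      have h := hFsum.prod
      simp only [Function.uncurry] at h
      exact h.congr fun b' => hrowq b'
    have hKrow : ∑' q : X d, K p q * ∑' b' : X d, N b' b₀ * ΨK b' q = ∑' b' : X d, N b' b₀ * ∑' q : X d, K p q * ΨK b' q := by
      have e1 : ∀ q, K p q * ∑' b' : X d, N b' b₀ * ΨK b' q = ∑' b' : X d, F b' q := fun q => by
        rw [← tsum_mul_left]; exact tsum_congr fun b' => by rw [hF]
      rw [tsum_congr e1, hFsum.tsum_comm, tsum_congr hrowq]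
    -- termwise: `(H_V + K)(N(b′,b₀)Ψ^K_{b′})(p) = N(b′,b₀)𝟙[blk n p = b′]`, summed over `b′`
    have hpt : ∑' b' : X d, (((n : ℝ) + 1) ^ 2 * ∑ μ', (2 * (N b' b₀ * ΨK b' p) - N b' b₀ * ΨK b' (p + e μ') - N b' b₀ * ΨK b' (p - e μ'))
        + a / ((n : ℝ) + 1) ^ d * ∑ q ∈ B n (blk n p), N b' b₀ * ΨK b' q + V p * (N b' b₀ * ΨK b' p)
        + N b' b₀ * ∑' q : X d, K p q * ΨK b' q) = N (blk n p) b₀ := by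
      have e1 : ∀ b', ((n : ℝ) + 1) ^ 2 * ∑ μ', (2 * (N b' b₀ * ΨK b' p) - N b' b₀ * ΨK b' (p + e μ') - N b' b₀ * ΨK b' (p - e μ'))
          + a / ((n : ℝ) + 1) ^ d * ∑ q ∈ B n (blk n p), N b' b₀ * ΨK b' q + V p * (N b' b₀ * ΨK b' p)
          + N b' b₀ * ∑' q : X d, K p q * ΨK b' q
          = N b' b₀ * (if blk n p = b' then 1 else 0) := by
        intro b'
        rw [← hΨK b' p, ← Finset.mul_sum]
        have e2 : ∑ μ', (2 * (N b' b₀ * ΨK b' p) - N b' b₀ * ΨK b' (p + e μ') - N b' b₀ * ΨK b' (p - e μ'))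
            = N b' b₀ * ∑ μ', (2 * ΨK b' p - ΨK b' (p + e μ') - ΨK b' (p - e μ')) := by
          rw [Finset.mul_sum]; exact Finset.sum_congr rfl fun μ' _ => by ring
        rw [e2]; ring
      simp only [e1]
      rw [tsum_eq_single (blk n p) (fun b' hb' => by rw [if_neg (Ne.symm hb'), mul_zero]), if_pos rfl, mul_one]
    have hS1 : ∀ μ' : Fin d, Summable fun b' : X d =>
        2 * (N b' b₀ * ΨK b' p) - N b' b₀ * ΨK b' (p + e μ') - N b' b₀ * ΨK b' (p - e μ') :=
      fun μ' => (((hs p).mul_left 2).sub (hs (p + e μ'))).sub (hs (p - e μ'))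
    have hS1s : Summable fun b' : X d =>
        ∑ μ', (2 * (N b' b₀ * ΨK b' p) - N b' b₀ * ΨK b' (p + e μ') - N b' b₀ * ΨK b' (p - e μ')) :=
      summable_sum fun μ' _ => hS1 μ'
    have hS2 : Summable fun b' : X d => ∑ q ∈ B n (blk n p), N b' b₀ * ΨK b' q := summable_sum fun q _ => hs q
    have hT1 : ∑' b' : X d, ∑ μ', (2 * (N b' b₀ * ΨK b' p) - N b' b₀ * ΨK b' (p + e μ') - N b' b₀ * ΨK b' (p - e μ'))
        = ∑ μ', (2 * (∑' b' : X d, N b' b₀ * ΨK b' p) - (∑' b' : X d, N b' b₀ * ΨK b' (p + e μ'))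
          - (∑' b' : X d, N b' b₀ * ΨK b' (p - e μ'))) := by
      rw [Summable.tsum_finsetSum fun μ' _ => hS1 μ']
      refine Finset.sum_congr rfl fun μ' _ => ?_
      rw [(((hs p).mul_left 2).sub (hs (p + e μ'))).tsum_sub (hs (p - e μ')), ((hs p).mul_left 2).tsum_sub (hs (p + e μ')),
        (hs p).tsum_mul_left 2]
    have hT2 : ∑' b' : X d, ∑ q ∈ B n (blk n p), N b' b₀ * ΨK b' q = ∑ q ∈ B n (blk n p), ∑' b' : X d, N b' b₀ * ΨK b' q :=
      Summable.tsum_finsetSum fun q _ => hs q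
    have hmain : ∑' b' : X d, (((n : ℝ) + 1) ^ 2 * ∑ μ', (2 * (N b' b₀ * ΨK b' p) - N b' b₀ * ΨK b' (p + e μ')
          - N b' b₀ * ΨK b' (p - e μ'))
        + a / ((n : ℝ) + 1) ^ d * ∑ q ∈ B n (blk n p), N b' b₀ * ΨK b' q + V p * (N b' b₀ * ΨK b' p)
        + N b' b₀ * ∑' q : X d, K p q * ΨK b' q)
        = ((n : ℝ) + 1) ^ 2 * ∑' b' : X d, ∑ μ', (2 * (N b' b₀ * ΨK b' p) - N b' b₀ * ΨK b' (p + e μ') - N b' b₀ * ΨK b' (p - e μ'))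
          + a / ((n : ℝ) + 1) ^ d * ∑' b' : X d, ∑ q ∈ B n (blk n p), N b' b₀ * ΨK b' q
          + V p * ∑' b' : X d, N b' b₀ * ΨK b' p + ∑' b' : X d, N b' b₀ * ∑' q : X d, K p q * ΨK b' q := by
      rw [Summable.tsum_add (((hS1s.mul_left _).add (hS2.mul_left _)).add ((hs p).mul_left _)) hSK,
        Summable.tsum_add ((hS1s.mul_left _).add (hS2.mul_left _)) ((hs p).mul_left _),
        Summable.tsum_add (hS1s.mul_left _) (hS2.mul_left _), hS1s.tsum_mul_left (((n : ℝ) + 1) ^ 2),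
        hS2.tsum_mul_left (a / ((n : ℝ) + 1) ^ d), (hs p).tsum_mul_left (V p)]
    rw [← hpt, hmain, hT1, hT2, hKrow]

/-! ## §2. Toy -/

/-- Toy (`d = 3`): the no-loss convolution behind (i) — rates `1 < 2` around the origin of `ℤ³`. -/
example : Summable (fun c : X 3 => exp (-(2 * ∑ i, ((((0 : X 3) i - c i).natAbs : ℕ) : ℝ)))
    * exp (-(1 * ∑ i, (((c i - (0 : X 3) i).natAbs : ℕ) : ℝ)))) :=
  (tsum_exp_conv_noLoss (d := 3) zero_le_one one_lt_two 0 0).1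

end Summit.QuantumFields.BalabanUV.T4Continuum.NE7b.SupZdPerturbedResponseKernel
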